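import Literature.Analysis.Complex.FlatTubeFourier
import HarnessLib

/-!
# The flat tube theorem by Fourier transform, IV: bounds uniform over a family of functionals

Analysis/Complex support file (everything proved; no definitions, no named facts), a supplement to
`FlatTubeFourier`. The flat tube theorem of the tree
(`Literature.Analysis.Complex.exists_holomorphic_extension_l1Tube`, the Malgrange–Zerner theorem in
tempered form) produces, for a functional `T` on `k`-tuples of Schwartz functions whose slots are
holomorphic in a strip, a function `F` holomorphic on the tube over the `ℓ¹`-ball and **bounded on
every closed sub-tube** — but the bound is stated existentially, per functional. Its proof,
however, computes the bound from the two constants `C, N` of the hypothesis "the slot bounds grow at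
most like `C (1 + ‖p‖)ᴺ` at the tuples of modulated Gaussians" and from `a, b, κ, k` alone. This file
records that observation as a theorem about **families** `(T_ω)_{ω ∈ Ω}` of such functionals: if the
polynomial bounds hold with the *same* `C(c), N(c)` for all `ω`, then the holomorphic extensions
`F_ω` obey a *common* bound on each closed sub-tube
(`exists_holomorphic_extension_l1Tube_uniform`; the order of quantifiers `∃ K, ∀ ω` is the content).

This uniformity is what makes the theorem usable on *regularised* distributions: in
Osterwalder–Schrader, *Axioms for Euclidean Green's functions II*, Comm. Math. Phys. 42 (1975),
Ch. VI.1, the Malgrange–Zerner theorem is applied (p. 300, (6.13)–(6.15)) to the regularisations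
`T_k = S_k ∗ k_ρ` of the Schwinger functions, with slot bounds controlled by the linear growth
condition E0' through norms of the regularising kernels, and the resulting bound on the joint
continuation must be tracked as a function of those norms ("This bound holds uniformly in the
parameters `y, y'` on which `T_k` also depends", p. 300) in order to remove the regularisation.

* `norm_fourierLaplace_le_of_decay` — the sub-tube bound for a Fourier–Laplace integral with
  *explicit* constant: if `‖Φ(p)‖ ≤ C (1 + ‖p‖)ᴺ e^{-2πc₁‖p‖}` then
  `‖∫ Φ(p) e^{2πi p·z} dp‖ ≤ ∫ C (1 + ‖p‖)ᴺ e^{-2π(c₁ - c)‖p‖} dp` on `{∑ |Im zⱼ| ≤ c}`, `c < c₁`;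
* `norm_fourierData_le_uniform` — the decay of the Gaussian-windowed Fourier data
  `Φ(p) = T(ψ_{p_1}, …, ψ_{p_k})` with explicit constant, from explicit slot bounds;
* `exists_holomorphic_extension_l1Tube_uniform` — **the flat tube theorem for families**, with a
  sub-tube bound uniform in the family parameter (for `k ≥ 1` slots; with no slot there is no
  hypothesis and no uniformity).

## References

* K. Osterwalder, R. Schrader, *Axioms for Euclidean Green's functions II*, Comm. Math. Phys. 42
  (1975) 281–305, Ch. V.1 p. 292 and Ch. VI.1 pp. 299–300. [OsterwalderSchraderCMP1975]
* H. Epstein, *Some analytic properties of scattering amplitudes in quantum field theory*,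
  Brandeis Summer Institute 1965, Gordon and Breach 1966 (the flat tube theorem).

Everything here is elementary and tagged folklore.
-/

noncomputable section

open _root_.Complex Set MeasureTheory Filter Real SchwartzMap Module
open scoped _root_.Topology FourierTransform

namespace Literature.Analysis.Complex

variable {k : ℕ} {a b κ : ℝ}

/-! ### Sub-tube bounds with explicit constants -/

/-- **Bound for the Fourier–Laplace integral on a closed sub-tube, explicit form**: if
`‖Φ(p)‖ ≤ C (1 + ‖p‖)ᴺ e^{-2πc₁‖p‖}` for all `p`, then for `c < c₁` and `∑ⱼ |Im zⱼ| ≤ c`,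
`‖∫ Φ(p) e^{2πi p·z} dp‖ ≤ ∫ C (1 + ‖p‖)ᴺ e^{-2π(c₁ - c)‖p‖} dp`. [folklore] -/
theorem norm_fourierLaplace_le_of_decay {Φ : (Fin k → ℝ) → ℂ} {C c c₁ : ℝ} {N : ℕ}
    (hC : ∀ p, ‖Φ p‖ ≤ C * (1 + ‖p‖) ^ N * Real.exp (-(2 * π * c₁ * ‖p‖))) (hc : c < c₁)
    {z : Fin k → ℂ} (hz : ∑ j, |(z j).im| ≤ c) :
    ‖∫ p : Fin k → ℝ, Φ p * Complex.exp (2 * π * I * ∑ j, (p j : ℂ) * z j)‖ ≤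
      ∫ p : Fin k → ℝ, C * ((1 + ‖p‖) ^ N * Real.exp (-(2 * π * (c₁ - c)) * ‖p‖)) := by
  have hδ : 0 < 2 * π * (c₁ - c) := by nlinarith [Real.pi_pos]
  refine norm_integral_le_of_norm_le ((integrable_one_add_norm_pow_mul_exp_neg hδ N).const_mul C)
    (Eventually.of_forall fun p => ?_)
  rw [norm_mul]
  calc ‖Φ p‖ * ‖Complex.exp (2 * π * I * ∑ j, (p j : ℂ) * z j)‖
      ≤ (C * (1 + ‖p‖) ^ N * Real.exp (-(2 * π * c₁ * ‖p‖))) * Real.exp (2 * π * ‖p‖ * c) := by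
        refine mul_le_mul (hC p) ((norm_cexp_two_pi_I_sum_le p z).trans (Real.exp_le_exp.2 ?_))
          (norm_nonneg _) (le_trans (norm_nonneg _) (hC p))
        exact mul_le_mul_of_nonneg_left hz (by positivity)
    _ = C * ((1 + ‖p‖) ^ N * Real.exp (-(2 * π * (c₁ - c)) * ‖p‖)) := by
        rw [mul_assoc, mul_assoc, mul_assoc, ← Real.exp_add]
        congr 3
        ring

/-- **Decay of the Gaussian-windowed Fourier data, explicit form.** If at the tuple of modulated
Gaussians `(ψ_{p_j})_j` every slot of `T` is represented in the strip `{|Im z| < a}` by a holomorphic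
function bounded by `C (1 + ‖p‖)ᴺ e^{κ|Re z|}` on `{|Im z| ≤ max c 0}` (`c < a`, `a > 0`), then
`‖T(ψ_{p_1}, …, ψ_{p_k})‖ ≤ C e^{2b (max c 0)²} (∫ e^{κ|x| - 2bx²} dx) (1 + ‖p‖)ᴺ e^{-2πc‖p‖}`
(`k ≥ 1`). [folklore] -/
theorem norm_fourierData_le_uniform [Nonempty (Fin k)] (hb : 0 < b) (ha : 0 < a) {c : ℝ} (hca : c < a)
    {T : (Fin k → ℝ → ℂ) → ℂ} {C : ℝ} {N : ℕ} {p : Fin k → ℝ}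
    (hslot : ∀ i : Fin k, ∃ g : ℂ → ℂ, DifferentiableOn ℂ g {z : ℂ | |z.im| < a} ∧
      (∀ z : ℂ, |z.im| ≤ max c 0 → ‖g z‖ ≤ C * (1 + ‖p‖) ^ N * Real.exp (κ * |z.re|)) ∧
      ∀ ϑ : 𝓢(ℝ, ℂ), T (Function.update
        (fun j (s : ℝ) => Complex.exp (-(b : ℂ) * (s : ℂ) ^ 2) * Complex.exp (↑(-2 * π * s * p j) * I))
        i ϑ) = ∫ s : ℝ, g s * Complex.exp (-(b : ℂ) * (s : ℂ) ^ 2) * ϑ s) :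
    ‖T (fun j (s : ℝ) => Complex.exp (-(b : ℂ) * (s : ℂ) ^ 2) * Complex.exp (↑(-2 * π * s * p j) * I))‖ ≤
      C * Real.exp (2 * b * (max c 0) ^ 2) * (∫ x : ℝ, Real.exp (κ * |x| - 2 * b * x ^ 2)) *
        (1 + ‖p‖) ^ N * Real.exp (-(2 * π * c * ‖p‖)) := by
  set c' : ℝ := max c 0 with hc'
  have hc'0 : 0 ≤ c' := le_max_right _ _
  have hc'a : c' < a := max_lt hca ha
  have h := norm_apply_gaussMod_le hb hc'0 hc'a hslot
  refine h.trans ?_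
  obtain ⟨i⟩ := (inferInstance : Nonempty (Fin k))
  obtain ⟨g, -, hM, -⟩ := hslot i
  have hCp : 0 ≤ C * (1 + ‖p‖) ^ N :=
    nonneg_of_norm_le_mul_exp (κ := κ) fun x => by simpa using hM x (by simpa using hc'0)
  have hK : 0 ≤ ∫ x : ℝ, Real.exp (κ * |x| - 2 * b * x ^ 2) :=
    (integral_exp_mul_abs_sub_mul_sq_pos (by positivity : 0 < 2 * b) κ).le
  have hexp : Real.exp (-(2 * π * c' * ‖p‖)) ≤ Real.exp (-(2 * π * c * ‖p‖)) := by
    have hcc : c * ‖p‖ ≤ c' * ‖p‖ := mul_le_mul_of_nonneg_right (le_max_left c 0) (norm_nonneg p)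
    exact Real.exp_le_exp.2 (by nlinarith [hcc, Real.pi_pos])
  calc C * Real.exp (2 * b * c' ^ 2) * (∫ x : ℝ, Real.exp (κ * |x| - 2 * b * x ^ 2)) *
        (1 + ‖p‖) ^ N * Real.exp (-(2 * π * c' * ‖p‖))
      = (C * (1 + ‖p‖) ^ N) * (Real.exp (2 * b * c' ^ 2) *
          ∫ x : ℝ, Real.exp (κ * |x| - 2 * b * x ^ 2)) * Real.exp (-(2 * π * c' * ‖p‖)) := by ring
    _ ≤ (C * (1 + ‖p‖) ^ N) * (Real.exp (2 * b * c' ^ 2) *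
          ∫ x : ℝ, Real.exp (κ * |x| - 2 * b * x ^ 2)) * Real.exp (-(2 * π * c * ‖p‖)) := by
        gcongr
    _ = C * Real.exp (2 * b * c' ^ 2) * (∫ x : ℝ, Real.exp (κ * |x| - 2 * b * x ^ 2)) *
        (1 + ‖p‖) ^ N * Real.exp (-(2 * π * c * ‖p‖)) := by ring

/-! ### The flat tube theorem for families -/

/-- **The flat tube theorem with bounds uniform over a family.** Let `a, b > 0`, `κ ∈ ℝ`, `k ≥ 1`,
and let `(T_ω)_{ω ∈ Ω}` be functionals on `k`-tuples of functions `ℝ → ℂ` with bound functionals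
`B_ω,ᵢ` such that, for every `ω`,

* (slot representations) for every slot `i` and every tuple `θ` of Schwartz functions there is `g`
  holomorphic in the strip `{|Im z| < a}`, with `‖g(x + iy)‖ ≤ B_ω,ᵢ(θ, c) e^{κ|x|}` for
  `|y| ≤ c < a`, and `T_ω(θ[i ↦ ϑ]) = ∫ g(s) e^{-bs²} ϑ(s) ds` for all Schwartz `ϑ`;
* (polynomial bounds, *uniform in `ω`*) for every `c < a`:
  `B_ω,ᵢ((ψ_{p_j})_j, c) ≤ C(c) (1 + ‖p‖)^{N(c)}` at the tuples of modulated Gaussians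
  `ψ_q(s) = e^{-bs²} e^{-2πiqs}`, with `C(c), N(c)` not depending on `ω`.

Then there are `F_ω : ℂᵏ → ℂ`, complex differentiable on the tube over the `ℓ¹`-ball
`{∑ⱼ |Im zⱼ| < a}`, obeying **for every `c < a` a common bound `‖F_ω z‖ ≤ K(c)` on
`{∑ⱼ |Im zⱼ| ≤ c}` for all `ω`**, and representing the functionals:
`T_ω(e^{-b·²}ϑ₁, …, e^{-b·²}ϑ_k) = ∫_{ℝᵏ} F_ω(x) ∏ⱼ ϑⱼ(xⱼ) dx` for all Schwartz `ϑⱼ`. (Same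
construction as `exists_holomorphic_extension_l1Tube` — `F_ω` is the Fourier–Laplace integral of
the Fourier data `p ↦ T_ω(ψ_{p_1}, …, ψ_{p_k})` — keeping track of the constants: for `c < a` one may
take `K(c) = ∫ C' (1 + ‖p‖)^{N'} e^{-π(a - c)‖p‖} dp` with `C' = C(c₁') e^{2bc₁'²} ∫ e^{κ|x| - 2bx²} dx`,
`N' = N(c₁')`, `c₁' = max ((c + a)/2) 0`.) [folklore] -/
theorem exists_holomorphic_extension_l1Tube_uniform {Ω : Type*} [Nonempty (Fin k)] (ha : 0 < a)
    (hb : 0 < b) (T : Ω → (Fin k → ℝ → ℂ) → ℂ) (B : Ω → Fin k → (Fin k → ℝ → ℂ) → ℝ → ℝ)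
    (hT : ∀ (ω : Ω) (i : Fin k) (θ : Fin k → 𝓢(ℝ, ℂ)), ∃ g : ℂ → ℂ,
      DifferentiableOn ℂ g {z : ℂ | |z.im| < a} ∧
      (∀ c : ℝ, c < a → ∀ z : ℂ, |z.im| ≤ c →
        ‖g z‖ ≤ B ω i (fun j => ⇑(θ j)) c * Real.exp (κ * |z.re|)) ∧
      ∀ ϑ : 𝓢(ℝ, ℂ), T ω (Function.update (fun j => ⇑(θ j)) i ϑ) =
        ∫ s : ℝ, g s * Complex.exp (-(b : ℂ) * (s : ℂ) ^ 2) * ϑ s)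
    (C : ℝ → ℝ) (N : ℝ → ℕ)
    (hB : ∀ c : ℝ, c < a → ∀ (ω : Ω) (i : Fin k) (p : Fin k → ℝ),
      B ω i (fun j (s : ℝ) => Complex.exp (-(b : ℂ) * (s : ℂ) ^ 2) *
        Complex.exp (↑(-2 * π * s * p j) * I)) c ≤ C c * (1 + ‖p‖) ^ N c) :
    ∃ F : Ω → (Fin k → ℂ) → ℂ,
      (∀ ω, DifferentiableOn ℂ (F ω) {z : Fin k → ℂ | ∑ j, |(z j).im| < a}) ∧
      (∀ c : ℝ, c < a → ∃ K : ℝ, ∀ (ω : Ω) (z : Fin k → ℂ), ∑ j, |(z j).im| ≤ c → ‖F ω z‖ ≤ K) ∧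
      ∀ (ω : Ω) (ϑ : Fin k → 𝓢(ℝ, ℂ)),
        T ω (fun j (s : ℝ) => Complex.exp (-(b : ℂ) * (s : ℂ) ^ 2) * ϑ j s) =
          ∫ x : Fin k → ℝ, F ω (fun j => (x j : ℂ)) * ∏ j, ϑ j (x j) := by
  -- the Gaussian-windowed Fourier data of each functional
  set Φ : Ω → (Fin k → ℝ) → ℂ := fun ω p => T ω (fun j (s : ℝ) =>
    Complex.exp (-(b : ℂ) * (s : ℂ) ^ 2) * Complex.exp (↑(-2 * π * s * p j) * I)) with hΦdef
  -- slot representations at tuples of modulated Gaussians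
  have hslot : ∀ (ω : Ω) (p : Fin k → ℝ) (i : Fin k), ∃ g : ℂ → ℂ,
      DifferentiableOn ℂ g {z : ℂ | |z.im| < a} ∧
      (∀ c : ℝ, c < a → ∀ z : ℂ, |z.im| ≤ c →
        ‖g z‖ ≤ B ω i (fun j (s : ℝ) => Complex.exp (-(b : ℂ) * (s : ℂ) ^ 2) *
          Complex.exp (↑(-2 * π * s * p j) * I)) c * Real.exp (κ * |z.re|)) ∧
      ∀ ϑ : 𝓢(ℝ, ℂ), T ω (Function.update (fun j (s : ℝ) => Complex.exp (-(b : ℂ) * (s : ℂ) ^ 2) *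
          Complex.exp (↑(-2 * π * s * p j) * I)) i ϑ) =
        ∫ s : ℝ, g s * Complex.exp (-(b : ℂ) * (s : ℂ) ^ 2) * ϑ s := by
    intro ω p i
    choose θ hθ using fun j => exists_schwartzMap_gaussMod hb (p j)
    have hθfun : (fun j => ⇑(θ j)) = fun j (s : ℝ) => Complex.exp (-(b : ℂ) * (s : ℂ) ^ 2) *
        Complex.exp (↑(-2 * π * s * p j) * I) := funext fun j => funext (hθ j)
    obtain ⟨g, hg, hM, hrep⟩ := hT ω i θ
    rw [hθfun] at hM hrep
    exact ⟨g, hg, hM, hrep⟩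
  -- slot representations with the explicit polynomial constants at a level `c < a`
  have hslotc : ∀ (c : ℝ), c < a → ∀ (ω : Ω) (p : Fin k → ℝ) (i : Fin k), ∃ g : ℂ → ℂ,
      DifferentiableOn ℂ g {z : ℂ | |z.im| < a} ∧
      (∀ z : ℂ, |z.im| ≤ c → ‖g z‖ ≤ C c * (1 + ‖p‖) ^ N c * Real.exp (κ * |z.re|)) ∧
      ∀ ϑ : 𝓢(ℝ, ℂ), T ω (Function.update (fun j (s : ℝ) => Complex.exp (-(b : ℂ) * (s : ℂ) ^ 2) *
          Complex.exp (↑(-2 * π * s * p j) * I)) i ϑ) =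
        ∫ s : ℝ, g s * Complex.exp (-(b : ℂ) * (s : ℂ) ^ 2) * ϑ s := by
    intro c hca ω p i
    obtain ⟨g, hg, hM, hrep⟩ := hslot ω p i
    exact ⟨g, hg, fun z hz => (hM c hca z hz).trans
      (mul_le_mul_of_nonneg_right (hB c hca ω i p) (Real.exp_pos _).le), hrep⟩
  -- real-line bounds (`c = 0`): continuity of `Φ ω`
  have hslot0 : ∀ (ω : Ω) (p : Fin k → ℝ) (i : Fin k), ∃ g : ℂ → ℂ, ContinuousOn g {z : ℂ | |z.im| < a} ∧
      (∀ x : ℝ, ‖g x‖ ≤ C 0 * (1 + ‖p‖) ^ N 0 * Real.exp (κ * |x|)) ∧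
      ∀ ϑ : 𝓢(ℝ, ℂ), T ω (Function.update (fun j (s : ℝ) => Complex.exp (-(b : ℂ) * (s : ℂ) ^ 2) *
          Complex.exp (↑(-2 * π * s * p j) * I)) i ϑ) =
        ∫ s : ℝ, g s * Complex.exp (-(b : ℂ) * (s : ℂ) ^ 2) * ϑ s := by
    intro ω p i
    obtain ⟨g, hg, hM, hrep⟩ := hslotc 0 ha ω p i
    exact ⟨g, hg.continuousOn, fun x => by simpa using hM x (by simp), hrep⟩
  have hΦc : ∀ ω, Continuous (Φ ω) := fun ω => continuous_apply_gaussMod hb ha (hslot0 ω)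
  -- explicit decay constants, uniform in `ω`
  set Iκ : ℝ := ∫ x : ℝ, Real.exp (κ * |x| - 2 * b * x ^ 2) with hIκ
  set Cd : ℝ → ℝ := fun c => C (max c 0) * Real.exp (2 * b * (max c 0) ^ 2) * Iκ with hCd
  set Nd : ℝ → ℕ := fun c => N (max c 0) with hNd
  have hdecay : ∀ (c : ℝ), c < a → ∀ (ω : Ω) (p : Fin k → ℝ),
      ‖Φ ω p‖ ≤ Cd c * (1 + ‖p‖) ^ Nd c * Real.exp (-(2 * π * c * ‖p‖)) := by
    intro c hca ω p
    have hc'a : max c 0 < a := max_lt hca ha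
    have hslot' : ∀ i : Fin k, ∃ g : ℂ → ℂ, DifferentiableOn ℂ g {z : ℂ | |z.im| < a} ∧
        (∀ z : ℂ, |z.im| ≤ max c 0 → ‖g z‖ ≤ C (max c 0) * (1 + ‖p‖) ^ N (max c 0) *
          Real.exp (κ * |z.re|)) ∧
        ∀ ϑ : 𝓢(ℝ, ℂ), T ω (Function.update (fun j (s : ℝ) => Complex.exp (-(b : ℂ) * (s : ℂ) ^ 2) *
            Complex.exp (↑(-2 * π * s * p j) * I)) i ϑ) =
          ∫ s : ℝ, g s * Complex.exp (-(b : ℂ) * (s : ℂ) ^ 2) * ϑ s :=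
      fun i => hslotc (max c 0) hc'a ω p i
    have h := norm_fourierData_le_uniform (κ := κ) hb ha hca hslot'
    simpa only [hCd, hNd, hIκ] using h
  have hdecay' : ∀ ω, ∀ c : ℝ, c < a → ∃ (C' : ℝ) (N' : ℕ), ∀ p,
      ‖Φ ω p‖ ≤ C' * (1 + ‖p‖) ^ N' * Real.exp (-(2 * π * c * ‖p‖)) :=
    fun ω c hca => ⟨Cd c, Nd c, hdecay c hca ω⟩
  -- the Fourier–Laplace integrals
  refine ⟨fun ω z => ∫ p : Fin k → ℝ, Φ ω p * Complex.exp (2 * π * I * ∑ j, (p j : ℂ) * z j),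
    fun ω => differentiableOn_fourierLaplace_l1Tube (hΦc ω) (hdecay' ω), fun c hca => ?_,
    fun ω ϑ => ?_⟩
  · -- the common bound on the closed sub-tube of level `c`
    set c₁ : ℝ := (c + a) / 2 with hc₁
    have hc₁a : c₁ < a := by rw [hc₁]; linarith
    have hcc₁ : c < c₁ := by rw [hc₁]; linarith
    refine ⟨∫ p : Fin k → ℝ, Cd c₁ * ((1 + ‖p‖) ^ Nd c₁ * Real.exp (-(2 * π * (c₁ - c)) * ‖p‖)),
      fun ω z hz => ?_⟩
    exact norm_fourierLaplace_le_of_decay (hdecay c₁ hc₁a ω) hcc₁ hz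
  · -- integrability of `Φ ω` (decay at `c = a/2 > 0`)
    have hΦint : Integrable (Φ ω) := by
      have hC := hdecay (a / 2) (by linarith) ω
      refine ((integrable_one_add_norm_pow_mul_exp_neg (by positivity : 0 < 2 * π * (a / 2))
        (Nd (a / 2))).const_mul (Cd (a / 2))).mono' (hΦc ω).aestronglyMeasurable
        (Eventually.of_forall fun p => (hC p).trans (le_of_eq ?_))
      rw [mul_assoc]
      congr 2
      ring
    -- synthesis (`FlatTubeFourierSynthesis`) and Fubini
    have hsyn := apply_gaussian_mul_eq_integral_fourierData (κ := κ) hb ha k (T ω) (fun i θ => ?_)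
      ⟨C 0, N 0, hslot0 ω⟩ ϑ
    · rw [hsyn, ← integral_fourierLaplace_mul_prod_eq (hΦc ω) hΦint ϑ]
    · obtain ⟨g, hg, hM, hrep⟩ := hT ω i θ
      exact ⟨g, hg.continuousOn, ⟨B ω i (fun j => ⇑(θ j)) 0, fun x => by
        simpa using hM 0 ha x (by simp)⟩, hrep⟩

/-! ### The explicit extension and its bound; joint continuity over a family -/

/-- **The explicit holomorphic extension** of the flat tube theorem: the Fourier–Laplace integral
`F(z) = ∫ Φ(p) e^{2πi p·z} dp` of the Gaussian-windowed Fourier data `Φ(p) = T(ψ_{p_1}, …, ψ_{p_k})`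
(`ψ_q(s) = e^{-bs²} e^{-2πiqs}`). [folklore] -/
def l1TubeExtension (b : ℝ) (T : (Fin k → ℝ → ℂ) → ℂ) (z : Fin k → ℂ) : ℂ :=
  ∫ p : Fin k → ℝ, T (fun j (s : ℝ) => Complex.exp (-(b : ℂ) * (s : ℂ) ^ 2) *
    Complex.exp (↑(-2 * π * s * p j) * I)) * Complex.exp (2 * π * I * ∑ j, (p j : ℂ) * z j)

/-- The decay constant of the Fourier data at level `c`, from the slot-bound constants `C, N`:
`C(c⁺) e^{2b(c⁺)²} ∫ e^{κ|x| - 2bx²} dx`, `c⁺ = max c 0`. [folklore] -/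
def l1TubeDecayConst (b κ : ℝ) (C : ℝ → ℝ) (c : ℝ) : ℝ :=
  C (max c 0) * Real.exp (2 * b * (max c 0) ^ 2) * ∫ x : ℝ, Real.exp (κ * |x| - 2 * b * x ^ 2)

/-- **The explicit sub-tube bound** of the extension at level `c < a`, a function of
`a, b, κ, k, c` and the slot-bound constants `C, N` only:
`∫ C_d(c₁) (1 + ‖p‖)^{N(c₁⁺)} e^{-2π(c₁ - c)‖p‖} dp`, `c₁ = (c + a)/2`. [folklore] -/
def l1TubeBound (a b κ : ℝ) (k : ℕ) (C : ℝ → ℝ) (N : ℝ → ℕ) (c : ℝ) : ℝ :=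
  ∫ p : Fin k → ℝ, l1TubeDecayConst b κ C ((c + a) / 2) *
    ((1 + ‖p‖) ^ N (max ((c + a) / 2) 0) * Real.exp (-(2 * π * ((c + a) / 2 - c)) * ‖p‖))

/-- **The flat tube theorem, explicit form.** Under the hypotheses of
`exists_holomorphic_extension_l1Tube` with the polynomial slot bounds given by constant functions
`C(c), N(c)` (`k ≥ 1`), the explicit extension `l1TubeExtension b T` is holomorphic on the tube over
the `ℓ¹`-ball, is bounded on the closed sub-tube of level `c < a` by the explicit constant
`l1TubeBound a b κ k C N c`, and represents `T`. [folklore] -/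
theorem l1TubeExtension_spec [Nonempty (Fin k)] (ha : 0 < a) (hb : 0 < b)
    (T : (Fin k → ℝ → ℂ) → ℂ) (B : Fin k → (Fin k → ℝ → ℂ) → ℝ → ℝ)
    (hT : ∀ (i : Fin k) (θ : Fin k → 𝓢(ℝ, ℂ)), ∃ g : ℂ → ℂ,
      DifferentiableOn ℂ g {z : ℂ | |z.im| < a} ∧
      (∀ c : ℝ, c < a → ∀ z : ℂ, |z.im| ≤ c →
        ‖g z‖ ≤ B i (fun j => ⇑(θ j)) c * Real.exp (κ * |z.re|)) ∧
      ∀ ϑ : 𝓢(ℝ, ℂ), T (Function.update (fun j => ⇑(θ j)) i ϑ) =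
        ∫ s : ℝ, g s * Complex.exp (-(b : ℂ) * (s : ℂ) ^ 2) * ϑ s)
    (C : ℝ → ℝ) (N : ℝ → ℕ)
    (hB : ∀ c : ℝ, c < a → ∀ (i : Fin k) (p : Fin k → ℝ),
      B i (fun j (s : ℝ) => Complex.exp (-(b : ℂ) * (s : ℂ) ^ 2) *
        Complex.exp (↑(-2 * π * s * p j) * I)) c ≤ C c * (1 + ‖p‖) ^ N c) :
    DifferentiableOn ℂ (l1TubeExtension b T) {z : Fin k → ℂ | ∑ j, |(z j).im| < a} ∧
      (∀ c : ℝ, c < a → ∀ z : Fin k → ℂ, ∑ j, |(z j).im| ≤ c →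
        ‖l1TubeExtension b T z‖ ≤ l1TubeBound a b κ k C N c) ∧
      (∀ ϑ : Fin k → 𝓢(ℝ, ℂ),
        T (fun j (s : ℝ) => Complex.exp (-(b : ℂ) * (s : ℂ) ^ 2) * ϑ j s) =
          ∫ x : Fin k → ℝ, l1TubeExtension b T (fun j => (x j : ℂ)) * ∏ j, ϑ j (x j)) ∧
      (Continuous fun p : Fin k → ℝ => T (fun j (s : ℝ) =>
        Complex.exp (-(b : ℂ) * (s : ℂ) ^ 2) * Complex.exp (↑(-2 * π * s * p j) * I))) ∧
      ∀ c : ℝ, c < a → ∀ p : Fin k → ℝ,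
        ‖T (fun j (s : ℝ) => Complex.exp (-(b : ℂ) * (s : ℂ) ^ 2) *
          Complex.exp (↑(-2 * π * s * p j) * I))‖ ≤
          l1TubeDecayConst b κ C c * (1 + ‖p‖) ^ N (max c 0) * Real.exp (-(2 * π * c * ‖p‖)) := by
  -- the data, their continuity and their decay with the explicit constants
  set Φ : (Fin k → ℝ) → ℂ := fun p => T (fun j (s : ℝ) =>
    Complex.exp (-(b : ℂ) * (s : ℂ) ^ 2) * Complex.exp (↑(-2 * π * s * p j) * I)) with hΦdef
  have hslotc : ∀ (c : ℝ), c < a → ∀ (p : Fin k → ℝ) (i : Fin k), ∃ g : ℂ → ℂ,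
      DifferentiableOn ℂ g {z : ℂ | |z.im| < a} ∧
      (∀ z : ℂ, |z.im| ≤ c → ‖g z‖ ≤ C c * (1 + ‖p‖) ^ N c * Real.exp (κ * |z.re|)) ∧
      ∀ ϑ : 𝓢(ℝ, ℂ), T (Function.update (fun j (s : ℝ) => Complex.exp (-(b : ℂ) * (s : ℂ) ^ 2) *
          Complex.exp (↑(-2 * π * s * p j) * I)) i ϑ) =
        ∫ s : ℝ, g s * Complex.exp (-(b : ℂ) * (s : ℂ) ^ 2) * ϑ s := by
    intro c hca p i
    choose θ hθ using fun j => exists_schwartzMap_gaussMod hb (p j)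
    have hθfun : (fun j => ⇑(θ j)) = fun j (s : ℝ) => Complex.exp (-(b : ℂ) * (s : ℂ) ^ 2) *
        Complex.exp (↑(-2 * π * s * p j) * I) := funext fun j => funext (hθ j)
    obtain ⟨g, hg, hM, hrep'⟩ := hT i θ
    rw [hθfun] at hM hrep'
    exact ⟨g, hg, fun z hz => (hM c hca z hz).trans
      (mul_le_mul_of_nonneg_right (hB c hca i p) (Real.exp_pos _).le), hrep'⟩
  have hslot0 : ∀ (p : Fin k → ℝ) (i : Fin k), ∃ g : ℂ → ℂ, ContinuousOn g {z : ℂ | |z.im| < a} ∧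
      (∀ x : ℝ, ‖g x‖ ≤ C 0 * (1 + ‖p‖) ^ N 0 * Real.exp (κ * |x|)) ∧
      ∀ ϑ : 𝓢(ℝ, ℂ), T (Function.update (fun j (s : ℝ) => Complex.exp (-(b : ℂ) * (s : ℂ) ^ 2) *
          Complex.exp (↑(-2 * π * s * p j) * I)) i ϑ) =
        ∫ s : ℝ, g s * Complex.exp (-(b : ℂ) * (s : ℂ) ^ 2) * ϑ s := by
    intro p i
    obtain ⟨g, hg, hM, hrep'⟩ := hslotc 0 ha p i
    exact ⟨g, hg.continuousOn, fun x => by simpa using hM x (by simp), hrep'⟩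
  have hΦc : Continuous Φ := continuous_apply_gaussMod hb ha hslot0
  have hdecay : ∀ (c : ℝ), c < a → ∀ (p : Fin k → ℝ),
      ‖Φ p‖ ≤ l1TubeDecayConst b κ C c * (1 + ‖p‖) ^ N (max c 0) * Real.exp (-(2 * π * c * ‖p‖)) := by
    intro c hca p
    have hc'a : max c 0 < a := max_lt hca ha
    have h := norm_fourierData_le_uniform (κ := κ) hb ha hca (fun i => hslotc (max c 0) hc'a p i)
    simpa only [l1TubeDecayConst] using h
  have hdecay' : ∀ c : ℝ, c < a → ∃ (C' : ℝ) (N' : ℕ), ∀ p,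
      ‖Φ p‖ ≤ C' * (1 + ‖p‖) ^ N' * Real.exp (-(2 * π * c * ‖p‖)) :=
    fun c hca => ⟨_, _, hdecay c hca⟩
  have hΦint : Integrable Φ := by
    have hC := hdecay (a / 2) (by linarith)
    refine ((integrable_one_add_norm_pow_mul_exp_neg (by positivity : 0 < 2 * π * (a / 2))
      (N (max (a / 2) 0))).const_mul (l1TubeDecayConst b κ C (a / 2))).mono' hΦc.aestronglyMeasurable
      (Eventually.of_forall fun p => (hC p).trans (le_of_eq ?_))
    rw [mul_assoc]
    congr 2
    ring
  refine ⟨differentiableOn_fourierLaplace_l1Tube hΦc hdecay', fun c hca z hz => ?_, fun ϑ => ?_, hΦc,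
    hdecay⟩
  · -- the explicit bound
    have hc₁a : (c + a) / 2 < a := by linarith
    have hcc₁ : c < (c + a) / 2 := by linarith
    exact norm_fourierLaplace_le_of_decay (hdecay ((c + a) / 2) hc₁a) hcc₁ hz
  · -- representation
    have hsyn := apply_gaussian_mul_eq_integral_fourierData (κ := κ) hb ha k T (fun i θ => ?_)
      ⟨C 0, N 0, hslot0⟩ ϑ
    · rw [hsyn, ← integral_fourierLaplace_mul_prod_eq hΦc hΦint ϑ]
      rfl
    · obtain ⟨g, hg, hM, hrep'⟩ := hT i θ
      exact ⟨g, hg.continuousOn, ⟨B i (fun j => ⇑(θ j)) 0, fun x => by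
        simpa using hM 0 ha x (by simp)⟩, hrep'⟩

/-- **Joint continuity of the explicit extensions over a family.** Let `(T_ω)_{ω ∈ Ω}` (`Ω` a
first-countable topological space) satisfy the hypotheses of the flat tube theorem with common
slot-bound constants `C(c), N(c)`, and suppose that the Fourier data depend continuously on `ω`:
`ω ↦ T_ω(ψ_{p_1}, …, ψ_{p_k})` is continuous for every `p`. Then
`(ω, z) ↦ (l1TubeExtension b (T ω)) z` is jointly continuous on `Ω × {∑ |Im zⱼ| < a}` (dominated
convergence for the parametric Fourier–Laplace integral; the `ω`-uniform decay of the data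
provides the majorant). [folklore] -/
theorem continuousOn_l1TubeExtension_family {Ω : Type*} [TopologicalSpace Ω]
    [FirstCountableTopology Ω] [Nonempty (Fin k)] (ha : 0 < a) (hb : 0 < b)
    (T : Ω → (Fin k → ℝ → ℂ) → ℂ) (B : Ω → Fin k → (Fin k → ℝ → ℂ) → ℝ → ℝ)
    (hT : ∀ (ω : Ω) (i : Fin k) (θ : Fin k → 𝓢(ℝ, ℂ)), ∃ g : ℂ → ℂ,
      DifferentiableOn ℂ g {z : ℂ | |z.im| < a} ∧
      (∀ c : ℝ, c < a → ∀ z : ℂ, |z.im| ≤ c →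
        ‖g z‖ ≤ B ω i (fun j => ⇑(θ j)) c * Real.exp (κ * |z.re|)) ∧
      ∀ ϑ : 𝓢(ℝ, ℂ), T ω (Function.update (fun j => ⇑(θ j)) i ϑ) =
        ∫ s : ℝ, g s * Complex.exp (-(b : ℂ) * (s : ℂ) ^ 2) * ϑ s)
    (C : ℝ → ℝ) (N : ℝ → ℕ)
    (hB : ∀ c : ℝ, c < a → ∀ (ω : Ω) (i : Fin k) (p : Fin k → ℝ),
      B ω i (fun j (s : ℝ) => Complex.exp (-(b : ℂ) * (s : ℂ) ^ 2) *
        Complex.exp (↑(-2 * π * s * p j) * I)) c ≤ C c * (1 + ‖p‖) ^ N c)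
    (hTc : ∀ p : Fin k → ℝ, Continuous fun ω : Ω => T ω (fun j (s : ℝ) =>
      Complex.exp (-(b : ℂ) * (s : ℂ) ^ 2) * Complex.exp (↑(-2 * π * s * p j) * I))) :
    ContinuousOn (fun q : Ω × (Fin k → ℂ) => l1TubeExtension b (T q.1) q.2)
      (univ ×ˢ {z : Fin k → ℂ | ∑ j, |(z j).im| < a}) := by
  -- continuity at every point, through an open sub-tube of level `c < a` containing it
  rintro ⟨ω₀, z₀⟩ hq
  have hz₀ : ∑ j, |(z₀ j).im| < a := (mem_prod.1 hq).2
  obtain ⟨c, hz₀c, hca⟩ := exists_between hz₀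
  have hVcont : Continuous fun z : Fin k → ℂ => ∑ j, |(z j).im| :=
    continuous_finsetSum _ fun j _ => (continuous_abs.comp (Complex.continuous_im.comp (continuous_apply j)))
  set U : Set (Ω × (Fin k → ℂ)) := univ ×ˢ {z : Fin k → ℂ | ∑ j, |(z j).im| < c} with hU
  have hUo : IsOpen U := isOpen_univ.prod (isOpen_lt hVcont continuous_const)
  have hqU : (ω₀, z₀) ∈ U := mk_mem_prod (mem_univ _) hz₀c
  suffices hcont : ContinuousOn (fun q : Ω × (Fin k → ℂ) => l1TubeExtension b (T q.1) q.2) U from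
    (hcont.continuousAt (hUo.mem_nhds hqU)).continuousWithinAt
  -- dominated convergence on `U`
  set c₁ : ℝ := (c + a) / 2 with hc₁
  have hc₁a : c₁ < a := by rw [hc₁]; linarith
  have hcc₁ : c < c₁ := by rw [hc₁]; linarith
  have hδ : 0 < 2 * π * (c₁ - c) := by nlinarith [Real.pi_pos]
  set Cd : ℝ := l1TubeDecayConst b κ C c₁ with hCd
  set N' : ℕ := N (max c₁ 0) with hN'
  unfold l1TubeExtension
  refine continuousOn_of_dominated (bound := fun p : Fin k → ℝ => Cd * ((1 + ‖p‖) ^ N' *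
    Real.exp (-(2 * π * (c₁ - c)) * ‖p‖))) ?_ ?_ ?_ ?_
  · intro q _
    obtain ⟨-, -, -, hΦc, -⟩ := l1TubeExtension_spec (κ := κ) ha hb (T q.1) (B q.1) (hT q.1) C N
      (fun c hc i p => hB c hc q.1 i p)
    exact (hΦc.mul (Complex.continuous_exp.comp (continuous_const.mul
      (continuous_finsetSum _ fun j _ => (Complex.continuous_ofReal.comp (continuous_apply j)).mul
        continuous_const)))).aestronglyMeasurable
  · intro q hqU'
    have hz : ∑ j, |(q.2 j).im| ≤ c := le_of_lt (mem_prod.1 hqU').2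
    obtain ⟨-, -, -, -, hdec⟩ := l1TubeExtension_spec (κ := κ) ha hb (T q.1) (B q.1) (hT q.1) C N
      (fun c hc i p => hB c hc q.1 i p)
    refine Eventually.of_forall fun p => ?_
    rw [norm_mul]
    have hC := hdec c₁ hc₁a p
    calc ‖T q.1 (fun j (s : ℝ) => Complex.exp (-(b : ℂ) * (s : ℂ) ^ 2) *
            Complex.exp (↑(-2 * π * s * p j) * I))‖ * ‖Complex.exp (2 * π * I * ∑ j, (p j : ℂ) * q.2 j)‖
        ≤ (Cd * (1 + ‖p‖) ^ N' * Real.exp (-(2 * π * c₁ * ‖p‖))) * Real.exp (2 * π * ‖p‖ * c) := by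
          refine mul_le_mul hC ((norm_cexp_two_pi_I_sum_le p q.2).trans (Real.exp_le_exp.2 ?_))
            (norm_nonneg _) (le_trans (norm_nonneg _) hC)
          exact mul_le_mul_of_nonneg_left hz (by positivity)
      _ = Cd * ((1 + ‖p‖) ^ N' * Real.exp (-(2 * π * (c₁ - c)) * ‖p‖)) := by
          rw [mul_assoc, mul_assoc, mul_assoc, ← Real.exp_add]
          congr 3
          ring
  · exact (integrable_one_add_norm_pow_mul_exp_neg hδ N').const_mul Cd
  · refine Eventually.of_forall fun p => Continuous.continuousOn ?_
    exact ((hTc p).comp continuous_fst).mul (Complex.continuous_exp.comp (continuous_const.mul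
      (continuous_finsetSum _ fun j _ => continuous_const.mul
        ((continuous_apply j).comp continuous_snd))))

end Literature.Analysis.Complex
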